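import Mathlib
import HarnessLib
import Literature.MathematicalPhysics.QuantumLattice.HubbardDiagonalQuadraticResummation
import Literature.MathematicalPhysics.QuantumLattice.HubbardShiftedCovarianceDecomposition
import Summits.HubbardSuperconductivity.HubbardSuperconductivity.Theorems.KLProgrammeKLRegimeEngineResummedSymbolResponse
import Summits.HubbardSuperconductivity.HubbardSuperconductivity.Theorems.KLProgrammeKLRegimeTwoVolumeResummedReadout
import Summits.HubbardSuperconductivity.HubbardSuperconductivity.Theorems.KLProgrammeKLRegimeSplitFrameLemmas

/-!
# K3 two-volume / two-cutoff legs at scale `n ≥ 1` ((E3f-F) rows C1/C2 of stub (e), stmt-…-20437; the (A3) scale-`n` step of VL, stmt-…-20440):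
# **RESUM ONLY THE FRAME MISMATCH** — the one-shot actions of ONE volume at two flow frames `K₁`, `K₂` differ by an explicit quadratic chain plus
# ONE Gaussian step with a SINGLE-SCALE covariance on top of the frame-`K₁` action

Cell gate-hubbard-kl, seat hubbard-kl-k3c4-p2 (g8; technique «Matsubara all-U»: exact covariance/Grassmann identities).  In scheme F the two volumes (or
the two Matsubara cutoffs) of a leg are compared EACH AT ITS OWN flow frame, close on private rates (`frameDist ≤ F_n/L₁ ≤ Λ_n/4`, k3c5-p2's
`…EngineTwoLegSpLegStepSplit`); the common-point defect (D) of that door has a FRAME part.  Notation: `Ψ_K = uvSymbolCT … K Λ` (symbol of `C^K_{>Λ}`,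
`Λ = Λ_n`), `𝒩_K = counterQuadratic … K`, `D = K₂ ⊖ K₁` (`fsub`), `κ_D(ks) = D(p_k⃗)/(βL²)`, `T(K) = klEffectiveAction … K e₀ n = effAction (normalCovariance Ψ_K) (V_U + 𝒩_K)`,
`Ψ̃ = Ψ_{K₂}/(1 + Ψ_{K₂}κ_D)`, `d = Ψ̃ − Ψ_{K₁}`, `m = (1 + Ψ_{K₂}κ_D)⁻¹`.
* §1 `counterQuadratic_eq_sum_smul`, `counterQuadratic_fsub` (`𝒩_{K₂⊖K₁} = 𝒩_{K₂} − 𝒩_{K₁}`), `one_add_uvSymbolCT_mul_ofReal_ne_zero` (`1 + Ψ_K·x/(βL²) ≠ 0`, ANY real `x`).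
* §2 `Ψ̃ = uvResummedFn (βL²) Λ ω_i (e_{K₁}(k⃗)) (D(p_k⃗))` (p2 g10's resummed symbol READ AT `(ξ, x) := (e_{K₁}, D)`, `mismatchResummed_eq_uvResummedFn`; `Ψ_{K₁}` is its
  value at `x = 0`), hence **`d` is SINGLE-SCALE**: zero wherever both frames are above the shell — in particular at EVERY `|ω_i| ≥ Λ` — and below both shells
  (`mismatchDefect_eq_zero_of_ge/_of_freq_ge/_of_le`), and `‖d‖ ≤ βL²(200+200B₁)/Λ²·|D(p_k⃗)|` under the SOLE smallness `|D(p_k⃗)| ≤ Λ/4`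
  (`norm_mismatchDefect_le`, ℓ¹ form `sum_norm_mismatchDefect_le`) — valid at every scale, whereas resumming the full frame needs `|K_n(p)| ≤ Λ_n/4`, false at deep
  scales (`HubbardResummedCovarianceDetBound`: «NOT claimed: anything at scales with Λ_n < 4‖K‖_∞»).
* §3 **`klEffectiveAction_eq_chain_add_map_mismatchResummed`**: `T(K₂) = effAction (normalCovariance Ψ_{K₂}) 𝒩_D + S_m·effAction (normalCovariance Ψ̃) (V_U + 𝒩_{K₁})`
  — the tree's all-degree resummation (`HubbardDiagonalQuadraticResummation`) at `p := Ψ_{K₂}`, `V := V_U + 𝒩_{K₁}`, `𝒩_κ := 𝒩_D`: ONLY the mismatch is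
  resummed, the frame `K₁` stays a vertex.
* §4 **`klEffectiveAction_eq_chain_add_map_nearIdentity`**: `normalCovariance` additivity + the semigroup `effAction_add` give
  `effAction (normalCovariance Ψ̃) (V_U + 𝒩_{K₁}) = effAction (normalCovariance d) (T(K₁))`, so `T(K₂) = chain_D + S_m·effAction_{normalCovariance d}(T(K₁))`:
  the frame mismatch is ONE Gaussian step with the tiny single-scale covariance `d` on top of the other frame's one-shot action (profile: (b)'s
  `KernelNormsV4 … K₁ n` / the (A3)-controlled one) — not a frame defect at every `j ≤ n`.
* §5 the reading (FST's chain + dressing, `klSelfEnergy_frame_eq_chain_add_dressed`) and, below the `K₂`-shell (`Ψ_{K₂}(k,σ) = 0`),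
  **`klSelfEnergy_frame_sub_eq_mismatch_add_response`**: `Σ[T(K₂)] − Σ[T(K₁)] = D(p_k⃗) + (Σ[effAction_{normalCovariance d}(T(K₁))] − Σ[T(K₁)])` at `(k,σ)`
  EXACTLY — the «coefficient-1» mismatch plus ONE near-identity covariance response (`covResp_norm_selfEnergy_sub_le`-type, entry sum from §2).
Everything is proved; no definitions; nothing about the sizes of `T` is asserted; nothing asserts superconductivity.  References: Feldman–Salmhofer–Trubowitz
1996 §1; Benfatto–Giuliani–Mastropietro 2006 §2.3 (2.21)–(2.24); Salmhofer 1999 §2.5.1 (2.106), §4.2.5 (4.70)–(4.71).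
-/

noncomputable section

namespace Summit.HubbardSuperconductivity.HubbardSuperconductivity.Theorems.TwoVolumeDefect

set_option linter.dupNamespace false -- summit = problem name (single-conjunct summit), D-0017

open Finset Complex Literature.MathematicalPhysics.QuantumLattice Literature.Probability.LatticeModels GrassmannAlgebra
open Summit.HubbardSuperconductivity.HubbardSuperconductivity.Theorems.KLRegimeSplit
open Summit.HubbardSuperconductivity.HubbardSuperconductivity.Theorems.KLProgrammeLegKernels
open Summit.HubbardSuperconductivity.HubbardSuperconductivity.Theorems.EngineV8

variable {L M : ℕ} [NeZero L]

/-! ## §1 Bookkeeping: the counterterm as a diagonal quadratic vertex; the mismatch vertex; the resummation denominator -/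
/-- **The counterterm vertex as a diagonal quadratic vertex** `𝒩_K = Σ_{ks} κ_K(ks)·ψ̂⁺_{ks}ψ̂⁻_{ks}`, `κ_K((k,σ)) = K(p_k⃗)/(βL²)` (the shape `hQ` of the
tree's resummation lemma). [cite: BenfattoGiulianiMastropietro2003, §1.2 The model (2.10)] -/
theorem counterQuadratic_eq_sum_smul (β : ℝ) (K : TrigPolyC4v) :
    counterQuadratic L M β K =
      ∑ ks : FreqMomentum L M × Fin 2, ((K.eval (latticeMomentum L ks.1.2) / (β * (L : ℝ) ^ 2) : ℝ) : ℂ) •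
        (gen ℂ ((ks, 0) : HubbardFieldIdx L M) * gen ℂ ((ks, 1) : HubbardFieldIdx L M)) := by
  simp only [counterQuadratic, psiPlus, psiMinus]
  exact (Fintype.sum_prod_type' (fun (k : FreqMomentum L M) (σ : Fin 2) =>
    ((K.eval (latticeMomentum L k.2) / (β * (L : ℝ) ^ 2) : ℝ) : ℂ) •
      (gen ℂ (((k, σ), 0) : HubbardFieldIdx L M) * gen ℂ (((k, σ), 1) : HubbardFieldIdx L M)))).symm

/-- **The mismatch vertex**: `𝒩_{K₂ ⊖ K₁} = 𝒩_{K₂} − 𝒩_{K₁}` (the counterterm vertex is linear in the frame's values). [folklore] -/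
theorem counterQuadratic_fsub (β : ℝ) (K₂ K₁ : TrigPolyC4v) :
    counterQuadratic L M β (fsub K₂ K₁) = counterQuadratic L M β K₂ - counterQuadratic L M β K₁ := by
  simp only [counterQuadratic, eval_fsub, sub_div, Complex.ofReal_sub, sub_smul, Finset.sum_sub_distrib]

/-- **The resummation denominator never vanishes, for ANY real insertion**: `1 + Ψ_K((i,k⃗),σ)·x/(βL²) ≠ 0` (`0 < β`), because
`(1 + Ψ·x/(βL²))·(−iω_i + e_K) = −iω_i + e_K + w·x` has imaginary part `−ω_i ≠ 0`.  No smallness of `x`. [cite: FeldmanSalmhoferTrubowitz1996, §1] -/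
theorem one_add_uvSymbolCT_mul_ofReal_ne_zero {β : ℝ} (hβ : 0 < β) (μ : ℝ) (K : TrigPolyC4v) (Λ x : ℝ)
    (ks : FreqMomentum L M × Fin 2) :
    1 + uvSymbolCT L M β μ K Λ ks * ((x / (β * (L : ℝ) ^ 2) : ℝ) : ℂ) ≠ 0 := by
  obtain ⟨⟨i, kv⟩, s⟩ := ks
  have hν : matsubaraFreq β M i ≠ 0 := matsubaraFreq_ne_zero hβ.ne' i
  have hL : (0 : ℝ) < L := by exact_mod_cast Nat.pos_of_ne_zero (NeZero.ne L)
  have hβL0 : (0 : ℝ) < β * (L : ℝ) ^ 2 := by positivity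
  have hβL : ((β * (L : ℝ) ^ 2 : ℝ) : ℂ) ≠ 0 := by exact_mod_cast hβL0.ne'
  have hz := neg_ofReal_mul_I_add_ne_zero hν (nambuXiCT L μ K kv)
  have hΨ : uvSymbolCT L M β μ K Λ ((i, kv), s) = ((β * (L : ℝ) ^ 2 : ℝ) : ℂ) *
      ((hubbardCutoffWeightCT L M β μ K Λ (i, kv) : ℂ) / (-((matsubaraFreq β M i : ℝ) : ℂ) * Complex.I + (nambuXiCT L μ K kv : ℂ))) := by
    rw [← uvSymbolCT_div_eq hβ μ K Λ i kv s]
    field_simp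
  have hk : ((x / (β * (L : ℝ) ^ 2) : ℝ) : ℂ) = (x : ℂ) / ((β * (L : ℝ) ^ 2 : ℝ) : ℂ) := by
    push_cast
    rfl
  have key : 1 + uvSymbolCT L M β μ K Λ ((i, kv), s) * ((x / (β * (L : ℝ) ^ 2) : ℝ) : ℂ) =
      (-((matsubaraFreq β M i : ℝ) : ℂ) * Complex.I + (nambuXiCT L μ K kv : ℂ) +
          (hubbardCutoffWeightCT L M β μ K Λ (i, kv) : ℂ) * (x : ℂ)) /
        (-((matsubaraFreq β M i : ℝ) : ℂ) * Complex.I + (nambuXiCT L μ K kv : ℂ)) := by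
    have hz2 : -(((matsubaraFreq β M i : ℝ) : ℂ) * Complex.I) + (nambuXiCT L μ K kv : ℂ) ≠ 0 := by
      simpa only [neg_mul] using hz
    rw [hΨ, hk, eq_div_iff hz]
    field_simp
  rw [key]
  exact div_ne_zero (neg_ofReal_mul_I_add_add_ne_zero hν _ _ _) hz

/-! ## §2 The resummed symbol is `uvResummedFn` at `(ξ, x) = (e_{K₁}, D(p))`; the defect `d = Ψ̃ − Ψ_{K₁}` is single-scale and `O(|D|/Λ²)` -/
section Symbol

variable {β : ℝ} (hβ : 0 < β) (μ : ℝ) (K₁ K₂ : TrigPolyC4v) (Λ : ℝ)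
include hβ

omit [NeZero L] hβ in
/-- `e_{K₂} = e_{K₁} − D(p_k⃗)`, `D = K₂ ⊖ K₁`. [folklore] -/
theorem nambuXiCT_eq_sub_eval_fsub (kv : TorusSite 2 L) :
    nambuXiCT L μ K₂ kv = nambuXiCT L μ K₁ kv - (fsub K₂ K₁).eval (latticeMomentum L kv) := by
  rw [nambuXiCT, nambuXiCT, eval_fsub]; ring

/-- **The mismatch-resummed symbol is `uvResummedFn (βL²) Λ ω_i (e_{K₁}(k⃗)) (D(p_k⃗))`** — p2 g10's resummed ultraviolet symbol read at the
frame-`K₁` band value and the MISMATCH (not at the free band and the full frame). [cite: BenfattoGiulianiMastropietro2006, §2.2 (2.23)] -/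
theorem mismatchResummed_eq_uvResummedFn (i : MatsubaraIdx M) (kv : TorusSite 2 L) (σ : Fin 2) :
    uvSymbolCT L M β μ K₂ Λ ((i, kv), σ) /
        (1 + uvSymbolCT L M β μ K₂ Λ ((i, kv), σ) * (((fsub K₂ K₁).eval (latticeMomentum L kv) / (β * (L : ℝ) ^ 2) : ℝ) : ℂ)) =
      uvResummedFn (β * (L : ℝ) ^ 2) Λ (matsubaraFreq β M i) (nambuXiCT L μ K₁ kv) ((fsub K₂ K₁).eval (latticeMomentum L kv)) := by
  rw [uvResummedFn, uvSymbolCT_eq_uvSymbolFn hβ, nambuXiCT_eq_sub_eval_fsub (L := L) μ K₁ K₂ kv]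

/-- **The frame-`K₁` symbol is the same function at `x = 0`**: `Ψ_{K₁}((i,k⃗),σ) = uvResummedFn (βL²) Λ ω_i (e_{K₁}(k⃗)) 0`. [folklore] -/
theorem uvSymbolCT_eq_uvResummedFn_zero (i : MatsubaraIdx M) (kv : TorusSite 2 L) (σ : Fin 2) :
    uvSymbolCT L M β μ K₁ Λ ((i, kv), σ) = uvResummedFn (β * (L : ℝ) ^ 2) Λ (matsubaraFreq β M i) (nambuXiCT L μ K₁ kv) 0 := by
  rw [uvResummedFn, sub_zero, uvSymbolCT_eq_uvSymbolFn hβ]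
  simp

/-- **The defect vanishes where both frames are above the shell** (`Λ² ≤ ω_i² + e_{K_j}²`, `j = 1, 2`): there both symbols are the bare resolvent
`βL²/(−iω_i + e_{K₁})`. [cite: BenfattoGiulianiMastropietro2006, §2.2 (2.27)–(2.28)] -/
theorem mismatchDefect_eq_zero_of_ge (hΛ : 0 < Λ) (i : MatsubaraIdx M) (kv : TorusSite 2 L) (σ : Fin 2)
    (h₂ : Λ ^ 2 ≤ matsubaraFreq β M i ^ 2 + nambuXiCT L μ K₂ kv ^ 2) (h₁ : Λ ^ 2 ≤ matsubaraFreq β M i ^ 2 + nambuXiCT L μ K₁ kv ^ 2) :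
    uvSymbolCT L M β μ K₂ Λ ((i, kv), σ) /
          (1 + uvSymbolCT L M β μ K₂ Λ ((i, kv), σ) * (((fsub K₂ K₁).eval (latticeMomentum L kv) / (β * (L : ℝ) ^ 2) : ℝ) : ℂ)) -
        uvSymbolCT L M β μ K₁ Λ ((i, kv), σ) = 0 := by
  have hL : (0 : ℝ) < L := by exact_mod_cast NeZero.pos L
  rw [mismatchResummed_eq_uvResummedFn hβ μ K₁ K₂ Λ i kv σ, uvSymbolCT_eq_uvResummedFn_zero hβ μ K₁ Λ i kv σ]
  refine uvResummedFn_sub_eq_zero_of_weights_one (by positivity) (matsubaraFreq_ne_zero hβ.ne' i)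
    (uvWeightFn_eq_one_of_ge hΛ ?_) (uvWeightFn_eq_one_of_ge hΛ ?_)
  · rwa [← nambuXiCT_eq_sub_eval_fsub (L := L) μ K₁ K₂ kv]
  · rwa [sub_zero]

/-- **In particular the defect vanishes at every frequency `|ω_i| ≥ Λ`**: it is a SINGLE-SCALE symbol, for every pair of frames. [cite: BenfattoGiulianiMastropietro2006, §2.2 (2.27)–(2.28)] -/
theorem mismatchDefect_eq_zero_of_freq_ge (hΛ : 0 < Λ) (i : MatsubaraIdx M) (kv : TorusSite 2 L) (σ : Fin 2)
    (h : Λ ≤ |matsubaraFreq β M i|) :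
    uvSymbolCT L M β μ K₂ Λ ((i, kv), σ) /
          (1 + uvSymbolCT L M β μ K₂ Λ ((i, kv), σ) * (((fsub K₂ K₁).eval (latticeMomentum L kv) / (β * (L : ℝ) ^ 2) : ℝ) : ℂ)) -
        uvSymbolCT L M β μ K₁ Λ ((i, kv), σ) = 0 := by
  have hΛω : Λ ^ 2 ≤ matsubaraFreq β M i ^ 2 := by
    calc Λ ^ 2 ≤ |matsubaraFreq β M i| ^ 2 := by gcongr
      _ = matsubaraFreq β M i ^ 2 := sq_abs _
  exact mismatchDefect_eq_zero_of_ge hβ μ K₁ K₂ Λ hΛ i kv σ (hΛω.trans (le_add_of_nonneg_right (sq_nonneg _)))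
    (hΛω.trans (le_add_of_nonneg_right (sq_nonneg _)))

/-- **The defect vanishes where both frames are below the shell** (`ω_i² + e_{K_j}² ≤ Λ²/4`): there both symbols vanish. [cite: Salmhofer1999, §4.2.5 (4.71)] -/
theorem mismatchDefect_eq_zero_of_le (hΛ : 0 < Λ) (i : MatsubaraIdx M) (kv : TorusSite 2 L) (σ : Fin 2)
    (h₂ : matsubaraFreq β M i ^ 2 + nambuXiCT L μ K₂ kv ^ 2 ≤ Λ ^ 2 / 4) (h₁ : matsubaraFreq β M i ^ 2 + nambuXiCT L μ K₁ kv ^ 2 ≤ Λ ^ 2 / 4) :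
    uvSymbolCT L M β μ K₂ Λ ((i, kv), σ) /
          (1 + uvSymbolCT L M β μ K₂ Λ ((i, kv), σ) * (((fsub K₂ K₁).eval (latticeMomentum L kv) / (β * (L : ℝ) ^ 2) : ℝ) : ℂ)) -
        uvSymbolCT L M β μ K₁ Λ ((i, kv), σ) = 0 := by
  have hL : (0 : ℝ) < L := by exact_mod_cast NeZero.pos L
  have hc : β * (L : ℝ) ^ 2 ≠ 0 := by positivity
  have hω := matsubaraFreq_ne_zero hβ.ne' i
  rw [mismatchResummed_eq_uvResummedFn hβ μ K₁ K₂ Λ i kv σ, uvSymbolCT_eq_uvResummedFn_zero hβ μ K₁ Λ i kv σ,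
    uvResummedFn_eq_zero_of_weight hc hω (uvWeightFn_eq_zero_of_le hΛ ?_),
    uvResummedFn_eq_zero_of_weight hc hω (uvWeightFn_eq_zero_of_le hΛ ?_), sub_zero]
  · rwa [sub_zero]
  · rwa [← nambuXiCT_eq_sub_eval_fsub (L := L) μ K₁ K₂ kv]

/-- **The defect is `O(|D|/Λ²)` under the SOLE smallness `|D(p_k⃗)| ≤ Λ/4`**:
`‖Ψ̃((i,k⃗),σ) − Ψ_{K₁}((i,k⃗),σ)‖ ≤ βL²(200+200B₁)/Λ²·|D(p_k⃗)|` (`B₁ ≥ sup|χ₂′|`), at every scale and for every frame `K₁` — p2 g10's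
`norm_uvResummedFn_sub_le` at `x′ = 0`. [cite: BenfattoGiulianiMastropietro2006, §2.2 (2.23), (2.27)–(2.28)] -/
theorem norm_mismatchDefect_le {B₁ : ℝ} (hB0 : 0 ≤ B₁) (hB : ∀ y, |deriv salmhoferCutoff y| ≤ B₁) (hΛ : 0 < Λ)
    (i : MatsubaraIdx M) (kv : TorusSite 2 L) (σ : Fin 2) (hD : |(fsub K₂ K₁).eval (latticeMomentum L kv)| ≤ Λ / 4) :
    ‖uvSymbolCT L M β μ K₂ Λ ((i, kv), σ) /
          (1 + uvSymbolCT L M β μ K₂ Λ ((i, kv), σ) * (((fsub K₂ K₁).eval (latticeMomentum L kv) / (β * (L : ℝ) ^ 2) : ℝ) : ℂ)) -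
        uvSymbolCT L M β μ K₁ Λ ((i, kv), σ)‖ ≤
      β * (L : ℝ) ^ 2 * (200 + 200 * B₁) / Λ ^ 2 * |(fsub K₂ K₁).eval (latticeMomentum L kv)| := by
  have hL : (0 : ℝ) < L := by exact_mod_cast NeZero.pos L
  rw [mismatchResummed_eq_uvResummedFn hβ μ K₁ K₂ Λ i kv σ, uvSymbolCT_eq_uvResummedFn_zero hβ μ K₁ Λ i kv σ]
  have h := norm_uvResummedFn_sub_le (c := β * (L : ℝ) ^ 2) hB0 hB (by positivity) hΛ (matsubaraFreq_ne_zero hβ.ne' i)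
    (nambuXiCT L μ K₁ kv) (x := (fsub K₂ K₁).eval (latticeMomentum L kv)) (x' := 0) hD
    (by rw [abs_zero]; positivity)
  rwa [sub_zero] at h

/-- **ℓ¹ size of the defect over all labels**: if `|D(p_k⃗)| ≤ t ≤ Λ/4` at every lattice momentum then
`Σ_{ks} ‖Ψ̃(ks) − Ψ_{K₁}(ks)‖ ≤ #{ks : |ω| < Λ} · βL²(200+200B₁)/Λ² · t` (the entry sum `Σ_A |Ċ(A,Ā)| = 2Σ_ks‖d ks‖` of `Ċ = normalCovariance d` read by
`covResp_norm_selfEnergy_sub_le`; outside the frequency window the terms vanish). [cite: BenfattoGiulianiMastropietro2006, §2.2 (2.27)–(2.28)] -/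
theorem sum_norm_mismatchDefect_le {B₁ : ℝ} (hB0 : 0 ≤ B₁) (hB : ∀ y, |deriv salmhoferCutoff y| ≤ B₁) (hΛ : 0 < Λ)
    {t : ℝ} (ht : t ≤ Λ / 4) (hD : ∀ kv : TorusSite 2 L, |(fsub K₂ K₁).eval (latticeMomentum L kv)| ≤ t) :
    ∑ ks : FreqMomentum L M × Fin 2,
        ‖uvSymbolCT L M β μ K₂ Λ ks /
              (1 + uvSymbolCT L M β μ K₂ Λ ks * (((fsub K₂ K₁).eval (latticeMomentum L ks.1.2) / (β * (L : ℝ) ^ 2) : ℝ) : ℂ)) -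
            uvSymbolCT L M β μ K₁ Λ ks‖ ≤
      ((Finset.univ.filter fun ks : FreqMomentum L M × Fin 2 => |matsubaraFreq β M ks.1.1| < Λ).card : ℝ) *
        (β * (L : ℝ) ^ 2 * (200 + 200 * B₁) / Λ ^ 2 * t) := by
  classical
  have hL : (0 : ℝ) < L := by exact_mod_cast NeZero.pos L
  have ht0 : 0 ≤ t := (abs_nonneg _).trans (hD 0)
  have hC : 0 ≤ β * (L : ℝ) ^ 2 * (200 + 200 * B₁) / Λ ^ 2 * t := by positivity
  calc ∑ ks : FreqMomentum L M × Fin 2,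
        ‖uvSymbolCT L M β μ K₂ Λ ks /
              (1 + uvSymbolCT L M β μ K₂ Λ ks * (((fsub K₂ K₁).eval (latticeMomentum L ks.1.2) / (β * (L : ℝ) ^ 2) : ℝ) : ℂ)) -
            uvSymbolCT L M β μ K₁ Λ ks‖
      ≤ ∑ ks : FreqMomentum L M × Fin 2,
          (if |matsubaraFreq β M ks.1.1| < Λ then β * (L : ℝ) ^ 2 * (200 + 200 * B₁) / Λ ^ 2 * t else 0) := by
        refine Finset.sum_le_sum fun ks _ => ?_
        obtain ⟨⟨i, kv⟩, σ⟩ := ks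
        dsimp only
        split_ifs with h
        · refine (norm_mismatchDefect_le hβ μ K₁ K₂ Λ hB0 hB hΛ i kv σ ((hD kv).trans ht)).trans ?_
          exact mul_le_mul_of_nonneg_left (hD kv) (by positivity)
        · rw [mismatchDefect_eq_zero_of_freq_ge hβ μ K₁ K₂ Λ hΛ i kv σ (not_lt.1 h), norm_zero]
    _ = ((Finset.univ.filter fun ks : FreqMomentum L M × Fin 2 => |matsubaraFreq β M ks.1.1| < Λ).card : ℝ) *
          (β * (L : ℝ) ^ 2 * (200 + 200 * B₁) / Λ ^ 2 * t) := by
        rw [Finset.sum_ite, Finset.sum_const_zero, add_zero, Finset.sum_const, nsmul_eq_mul]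

end Symbol

/-! ## §3 The resummation of the MISMATCH: `T(K₂)` through `Ψ̃ = Ψ_{K₂}/(1 + Ψ_{K₂}κ_D)` and the vertex `V_U + 𝒩_{K₁}` -/
section Resum

variable {β : ℝ} (hβ : 0 < β) (U μ : ℝ) (K₁ K₂ : TrigPolyC4v) (e₀ : ℝ) (n : ℕ)
include hβ

/-- **`T(K₂) = chain_D + S_m·effAction (normalCovariance Ψ̃) (V_U + 𝒩_{K₁})`** — RESUM ONLY THE MISMATCH `D = K₂ ⊖ K₁` (`Ψ₂ = uvSymbolCT … K₂ (klScale e₀ n)`,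
`κ_D(ks) = D(p_k⃗)/(βL²)`, `Ψ̃ = Ψ₂/(1 + Ψ₂κ_D)`, `m(X) = (1 + Ψ₂(X₁)κ_D(X₁))⁻¹`; the undressed scale-`n` partition function of frame `K₂` nonzero).
[cite: BenfattoGiulianiMastropietro2006, §2.3 (2.21)–(2.24)] -/
theorem klEffectiveAction_eq_chain_add_map_mismatchResummed
    (hZ : effPartitionFn ℂ (normalCovariance L M (uvSymbolCT L M β μ K₂ (klScale e₀ n)))
      (hubbardInteraction L M β U + counterQuadratic L M β K₂) ≠ 0) :
    klEffectiveAction L M β U μ K₂ e₀ n =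
      effAction ℂ (normalCovariance L M (uvSymbolCT L M β μ K₂ (klScale e₀ n))) (counterQuadratic L M β (fsub K₂ K₁)) +
        ExteriorAlgebra.map (LinearMap.mulLeft ℂ fun X : HubbardFieldIdx L M =>
            (1 + uvSymbolCT L M β μ K₂ (klScale e₀ n) X.1 *
              (((fsub K₂ K₁).eval (latticeMomentum L X.1.1.2) / (β * (L : ℝ) ^ 2) : ℝ) : ℂ))⁻¹)
          (effAction ℂ (normalCovariance L M fun ks =>
              uvSymbolCT L M β μ K₂ (klScale e₀ n) ks /
                (1 + uvSymbolCT L M β μ K₂ (klScale e₀ n) ks *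
                  (((fsub K₂ K₁).eval (latticeMomentum L ks.1.2) / (β * (L : ℝ) ^ 2) : ℝ) : ℂ)))
            (hubbardInteraction L M β U + counterQuadratic L M β K₁)) := by
  -- the scale-`n` action in normal-covariance form, with the vertex split `V_U + 𝒩_{K₂} = (V_U + 𝒩_{K₁}) + 𝒩_D`
  have hsplit : hubbardInteraction L M β U + counterQuadratic L M β K₂ =
      (hubbardInteraction L M β U + counterQuadratic L M β K₁) + counterQuadratic L M β (fsub K₂ K₁) := by
    rw [counterQuadratic_fsub]; abel
  have hT : klEffectiveAction L M β U μ K₂ e₀ n =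
      effAction ℂ (normalCovariance L M (uvSymbolCT L M β μ K₂ (klScale e₀ n)))
        ((hubbardInteraction L M β U + counterQuadratic L M β K₁) + counterQuadratic L M β (fsub K₂ K₁)) := by
    rw [klEffectiveAction, hubbardEffectiveActionCT_def, hubbardInteractionCT, hubbardCovAboveCT_zero_seed_eq_normalCovariance_uvSymbolCT, hsplit]
  have hden : ∀ ks : FreqMomentum L M × Fin 2, 1 + uvSymbolCT L M β μ K₂ (klScale e₀ n) ks *
      (((fsub K₂ K₁).eval (latticeMomentum L ks.1.2) / (β * (L : ℝ) ^ 2) : ℝ) : ℂ) ≠ 0 := fun ks =>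
    one_add_uvSymbolCT_mul_ofReal_ne_zero hβ μ K₂ (klScale e₀ n) _ ks
  have hV0 : constPart ℂ (hubbardInteraction L M β U + counterQuadratic L M β K₁) = 0 := by
    rw [map_add, constPart_hubbardInteraction, constPart_counterQuadratic, add_zero]
  have hZ' : effPartitionFn ℂ (normalCovariance L M (uvSymbolCT L M β μ K₂ (klScale e₀ n)))
      ((hubbardInteraction L M β U + counterQuadratic L M β K₁) + counterQuadratic L M β (fsub K₂ K₁)) ≠ 0 := by
    rwa [← hsplit]
  rw [hT]
  exact effAction_normalCovariance_add_diagQuadratic_of_ne_zero (uvSymbolCT L M β μ K₂ (klScale e₀ n))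
    (fun ks => (((fsub K₂ K₁).eval (latticeMomentum L ks.1.2) / (β * (L : ℝ) ^ 2) : ℝ) : ℂ)) hden
    (counterQuadratic_eq_sum_smul β (fsub K₂ K₁)) hV0 hZ'


/-! ## §4 The semigroup form: the frame mismatch is ONE Gaussian step with covariance `normalCovariance d` on top of `T(K₁)` -/
omit hβ in
/-- **Semigroup**: with `d = Ψ̃ − Ψ_{K₁}` and a unit scale-`n` partition function at frame `K₁`,
`effAction (normalCovariance Ψ̃) (V_U + 𝒩_{K₁}) = effAction (normalCovariance d) (klEffectiveAction … K₁ e₀ n)` (`normalCovariance` is additive in the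
symbol; Salmhofer's semigroup `effAction (C₁ + C₂) V = effAction C₁ (effAction C₂ V)`). [cite: Salmhofer1999, §2.5.1 (2.106)] -/
theorem effAction_mismatchResummed_eq_effAction_defect_klEffectiveAction
    (hZ₁ : IsUnit (effPartitionFn ℂ (normalCovariance L M (uvSymbolCT L M β μ K₁ (klScale e₀ n)))
      (hubbardInteraction L M β U + counterQuadratic L M β K₁))) :
    effAction ℂ (normalCovariance L M fun ks =>
          uvSymbolCT L M β μ K₂ (klScale e₀ n) ks /
            (1 + uvSymbolCT L M β μ K₂ (klScale e₀ n) ks * (((fsub K₂ K₁).eval (latticeMomentum L ks.1.2) / (β * (L : ℝ) ^ 2) : ℝ) : ℂ)))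
        (hubbardInteraction L M β U + counterQuadratic L M β K₁) =
      effAction ℂ (normalCovariance L M fun ks =>
          uvSymbolCT L M β μ K₂ (klScale e₀ n) ks /
              (1 + uvSymbolCT L M β μ K₂ (klScale e₀ n) ks * (((fsub K₂ K₁).eval (latticeMomentum L ks.1.2) / (β * (L : ℝ) ^ 2) : ℝ) : ℂ)) -
            uvSymbolCT L M β μ K₁ (klScale e₀ n) ks)
        (klEffectiveAction L M β U μ K₁ e₀ n) := by
  have hsym : (fun ks : FreqMomentum L M × Fin 2 =>
      uvSymbolCT L M β μ K₂ (klScale e₀ n) ks /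
        (1 + uvSymbolCT L M β μ K₂ (klScale e₀ n) ks * (((fsub K₂ K₁).eval (latticeMomentum L ks.1.2) / (β * (L : ℝ) ^ 2) : ℝ) : ℂ))) =
      fun ks => (uvSymbolCT L M β μ K₂ (klScale e₀ n) ks /
          (1 + uvSymbolCT L M β μ K₂ (klScale e₀ n) ks * (((fsub K₂ K₁).eval (latticeMomentum L ks.1.2) / (β * (L : ℝ) ^ 2) : ℝ) : ℂ)) -
          uvSymbolCT L M β μ K₁ (klScale e₀ n) ks) + uvSymbolCT L M β μ K₁ (klScale e₀ n) ks := by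
    funext ks; rw [sub_add_cancel]
  have hT₁ : klEffectiveAction L M β U μ K₁ e₀ n =
      effAction ℂ (normalCovariance L M (uvSymbolCT L M β μ K₁ (klScale e₀ n))) (hubbardInteraction L M β U + counterQuadratic L M β K₁) := by
    rw [klEffectiveAction, hubbardEffectiveActionCT_def, hubbardInteractionCT, hubbardCovAboveCT_zero_seed_eq_normalCovariance_uvSymbolCT]
  conv_lhs => rw [hsym]
  rw [normalCovariance_add_symbol, effAction_add ℂ _ _ _ hZ₁, hT₁]

/-- **`T(K₂) = chain_D + S_m·effAction_{normalCovariance d}(T(K₁))`** — the one-shot actions of ONE volume (or cutoff) at two frames differ by the explicit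
quadratic chain of the mismatch `D = K₂ ⊖ K₁` through `C^{K₂}_{>Λ_n}`, an external-leg dressing `m = (1 + Ψ_{K₂}κ_D)⁻¹` (`= 1` wherever `Ψ_{K₂}` vanishes), and
ONE Gaussian integration with the SINGLE-SCALE covariance `normalCovariance (Ψ̃ − Ψ_{K₁})` (§2) applied to the frame-`K₁` action (`0 < β`; frame-`K₂`
partition function nonzero, frame-`K₁` one a unit). [cite: BenfattoGiulianiMastropietro2006, §2.3 (2.21)–(2.24)] -/
theorem klEffectiveAction_eq_chain_add_map_nearIdentity
    (hZ₂ : effPartitionFn ℂ (normalCovariance L M (uvSymbolCT L M β μ K₂ (klScale e₀ n)))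
      (hubbardInteraction L M β U + counterQuadratic L M β K₂) ≠ 0)
    (hZ₁ : IsUnit (effPartitionFn ℂ (normalCovariance L M (uvSymbolCT L M β μ K₁ (klScale e₀ n)))
      (hubbardInteraction L M β U + counterQuadratic L M β K₁))) :
    klEffectiveAction L M β U μ K₂ e₀ n =
      effAction ℂ (normalCovariance L M (uvSymbolCT L M β μ K₂ (klScale e₀ n))) (counterQuadratic L M β (fsub K₂ K₁)) +
        ExteriorAlgebra.map (LinearMap.mulLeft ℂ fun X : HubbardFieldIdx L M =>
            (1 + uvSymbolCT L M β μ K₂ (klScale e₀ n) X.1 *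
              (((fsub K₂ K₁).eval (latticeMomentum L X.1.1.2) / (β * (L : ℝ) ^ 2) : ℝ) : ℂ))⁻¹)
          (effAction ℂ (normalCovariance L M fun ks =>
              uvSymbolCT L M β μ K₂ (klScale e₀ n) ks /
                  (1 + uvSymbolCT L M β μ K₂ (klScale e₀ n) ks *
                    (((fsub K₂ K₁).eval (latticeMomentum L ks.1.2) / (β * (L : ℝ) ^ 2) : ℝ) : ℂ)) -
                uvSymbolCT L M β μ K₁ (klScale e₀ n) ks)
            (klEffectiveAction L M β U μ K₁ e₀ n)) := by
  rw [klEffectiveAction_eq_chain_add_map_mismatchResummed hβ U μ K₁ K₂ e₀ n hZ₂,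
    effAction_mismatchResummed_eq_effAction_defect_klEffectiveAction U μ K₁ K₂ e₀ n hZ₁]


/-! ## §5 The reading: the scale-`n` self-energy at frame `K₂` through the frame-`K₁` action plus one covariance response -/
omit hβ in
/-- `V_U + 𝒩_{K}` is even. -/
theorem hubbardInteraction_add_counterQuadratic_mem_evenPart (β U : ℝ) (K : TrigPolyC4v) :
    hubbardInteraction L M β U + counterQuadratic L M β K ∈ evenPart ℂ (HubbardFieldIdx L M) := by
  refine add_mem (hubbardInteraction_mem_evenPart β U) ((mem_evenPart_iff).2 ?_)
  rw [counterQuadratic]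
  exact Submodule.sum_mem _ fun k _ => Submodule.sum_mem _ fun σ _ =>
    Submodule.smul_mem _ _ (gen_mul_gen_mem_evenOdd_zero ℂ _ _)

/-- **The scale-`n` self-energy at frame `K₂`, mismatch resummed** (FST 1996 §1 at `V := V_U + 𝒩_{K₁}`, counterterm `D = K₂ ⊖ K₁`):
`Σ[T(K₂)](k,σ) = βL²κ_D − βL²κ_D²·Ψ̃(k,σ) + (1 − κ_D·Ψ̃(k,σ))²·Σ[effAction (normalCovariance d) (T(K₁))](k,σ)`, `κ_D = D(p_k⃗)/(βL²)`.
[cite: FeldmanSalmhoferTrubowitz1996, §1] -/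
theorem klSelfEnergy_frame_eq_chain_add_dressed
    (hZ₂ : IsUnit (effPartitionFn ℂ (normalCovariance L M (uvSymbolCT L M β μ K₂ (klScale e₀ n)))
      (hubbardInteraction L M β U + counterQuadratic L M β K₂)))
    (hZ₁ : IsUnit (effPartitionFn ℂ (normalCovariance L M (uvSymbolCT L M β μ K₁ (klScale e₀ n)))
      (hubbardInteraction L M β U + counterQuadratic L M β K₁)))
    (k : FreqMomentum L M) (σ : Fin 2) :
    klSelfEnergy L M β U μ K₂ e₀ n k σ =
      ((β * (L : ℝ) ^ 2 : ℝ) : ℂ) * (((fsub K₂ K₁).eval (latticeMomentum L k.2) / (β * (L : ℝ) ^ 2) : ℝ) : ℂ) -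
        ((β * (L : ℝ) ^ 2 : ℝ) : ℂ) * (((fsub K₂ K₁).eval (latticeMomentum L k.2) / (β * (L : ℝ) ^ 2) : ℝ) : ℂ) ^ 2 *
          (uvSymbolCT L M β μ K₂ (klScale e₀ n) (k, σ) /
            (1 + uvSymbolCT L M β μ K₂ (klScale e₀ n) (k, σ) * (((fsub K₂ K₁).eval (latticeMomentum L k.2) / (β * (L : ℝ) ^ 2) : ℝ) : ℂ))) +
        (1 - (((fsub K₂ K₁).eval (latticeMomentum L k.2) / (β * (L : ℝ) ^ 2) : ℝ) : ℂ) *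
            (uvSymbolCT L M β μ K₂ (klScale e₀ n) (k, σ) /
              (1 + uvSymbolCT L M β μ K₂ (klScale e₀ n) (k, σ) * (((fsub K₂ K₁).eval (latticeMomentum L k.2) / (β * (L : ℝ) ^ 2) : ℝ) : ℂ)))) ^ 2 *
          selfEnergy L M β (effAction ℂ (normalCovariance L M fun ks =>
              uvSymbolCT L M β μ K₂ (klScale e₀ n) ks /
                  (1 + uvSymbolCT L M β μ K₂ (klScale e₀ n) ks *
                    (((fsub K₂ K₁).eval (latticeMomentum L ks.1.2) / (β * (L : ℝ) ^ 2) : ℝ) : ℂ)) -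
                uvSymbolCT L M β μ K₁ (klScale e₀ n) ks)
            (klEffectiveAction L M β U μ K₁ e₀ n)) k σ := by
  have hsplit : hubbardInteraction L M β U + counterQuadratic L M β K₂ =
      (hubbardInteraction L M β U + counterQuadratic L M β K₁) + counterQuadratic L M β (fsub K₂ K₁) := by
    rw [counterQuadratic_fsub]; abel
  have hden : ∀ ks : FreqMomentum L M × Fin 2, 1 + uvSymbolCT L M β μ K₂ (klScale e₀ n) ks *
      (((fsub K₂ K₁).eval (latticeMomentum L ks.1.2) / (β * (L : ℝ) ^ 2) : ℝ) : ℂ) ≠ 0 := fun ks =>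
    one_add_uvSymbolCT_mul_ofReal_ne_zero hβ μ K₂ (klScale e₀ n) _ ks
  have hV0 : constPart ℂ (hubbardInteraction L M β U + counterQuadratic L M β K₁) = 0 := by
    rw [map_add, constPart_hubbardInteraction, constPart_counterQuadratic, add_zero]
  have hZ' : IsUnit (effPartitionFn ℂ (normalCovariance L M (uvSymbolCT L M β μ K₂ (klScale e₀ n)))
      ((hubbardInteraction L M β U + counterQuadratic L M β K₁) + counterQuadratic L M β (fsub K₂ K₁))) := by
    rwa [← hsplit]
  rw [klSelfEnergy_eq_selfEnergy_normalCovariance, hsplit,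
    selfEnergy_effAction_add_counterQuadratic (uvSymbolCT L M β μ K₂ (klScale e₀ n))
      (hubbardInteraction_add_counterQuadratic_mem_evenPart β U K₁) hV0 β (fsub K₂ K₁) hden hZ' k σ,
    effAction_mismatchResummed_eq_effAction_defect_klEffectiveAction U μ K₁ K₂ e₀ n hZ₁]

/-- **AT A READING POINT BELOW THE `K₂`-SHELL the frame difference of the scale-`n` self-energies is the MISMATCH plus ONE covariance response**:
if `Ψ_{K₂}(k,σ) = 0` then `Σ[T(K₂)](k,σ) − Σ[T(K₁)](k,σ) = D(p_k⃗) + (Σ[effAction (normalCovariance d) (T(K₁))](k,σ) − Σ[T(K₁)](k,σ))` EXACTLY, `d = Ψ̃ − Ψ_{K₁}`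
the single-scale defect of §2 (the bracket is what `covResp_norm_selfEnergy_sub_le` / a near-identity step bounds). [cite: FeldmanSalmhoferTrubowitz1996, §1] -/
theorem klSelfEnergy_frame_sub_eq_mismatch_add_response
    (hZ₂ : IsUnit (effPartitionFn ℂ (normalCovariance L M (uvSymbolCT L M β μ K₂ (klScale e₀ n)))
      (hubbardInteraction L M β U + counterQuadratic L M β K₂)))
    (hZ₁ : IsUnit (effPartitionFn ℂ (normalCovariance L M (uvSymbolCT L M β μ K₁ (klScale e₀ n)))
      (hubbardInteraction L M β U + counterQuadratic L M β K₁)))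
    (k : FreqMomentum L M) (σ : Fin 2) (hk : uvSymbolCT L M β μ K₂ (klScale e₀ n) (k, σ) = 0) :
    klSelfEnergy L M β U μ K₂ e₀ n k σ - klSelfEnergy L M β U μ K₁ e₀ n k σ =
      ((fsub K₂ K₁).eval (latticeMomentum L k.2) : ℂ) +
        (selfEnergy L M β (effAction ℂ (normalCovariance L M fun ks =>
              uvSymbolCT L M β μ K₂ (klScale e₀ n) ks /
                  (1 + uvSymbolCT L M β μ K₂ (klScale e₀ n) ks *
                    (((fsub K₂ K₁).eval (latticeMomentum L ks.1.2) / (β * (L : ℝ) ^ 2) : ℝ) : ℂ)) -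
                uvSymbolCT L M β μ K₁ (klScale e₀ n) ks)
            (klEffectiveAction L M β U μ K₁ e₀ n)) k σ -
          klSelfEnergy L M β U μ K₁ e₀ n k σ) := by
  have hβ' : (β : ℂ) ≠ 0 := by exact_mod_cast hβ.ne'
  have hL' : (L : ℂ) ≠ 0 := by exact_mod_cast NeZero.ne L
  rw [klSelfEnergy_frame_eq_chain_add_dressed hβ U μ K₁ K₂ e₀ n hZ₂ hZ₁ k σ, hk]
  have hκ : ((β * (L : ℝ) ^ 2 : ℝ) : ℂ) * (((fsub K₂ K₁).eval (latticeMomentum L k.2) / (β * (L : ℝ) ^ 2) : ℝ) : ℂ) =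
      ((fsub K₂ K₁).eval (latticeMomentum L k.2) : ℂ) := by
    push_cast
    field_simp
  simp only [zero_div, mul_zero, sub_zero, one_pow, one_mul]
  rw [hκ]
  ring

end Resum

end Summit.HubbardSuperconductivity.HubbardSuperconductivity.Theorems.TwoVolumeDefect

end
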